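import Summits.Parity.BatemanHorn.Theorems.AlmostPrimeZerosSystemLSDRealSegmentReduction
import Summits.Parity.BatemanHorn.Theorems.AlmostPrimeZerosSystemLSDRealSegmentLinearKernel
import Literature.NumberTheory.Sieve.BatemanHornMertensProduct
import HarnessLib

/-!
# `SystemLSDRealSegment` (stmt-Parity-11292), line `beta-thinned-root-kernel`: the open kernel law in REAL form,
# and the unconditional Type-I lower bound

The crux and the line's one open stub `BetaKernelLaw k f y` are typed over `ℂ` (normaliser
`x⁻¹ exp(k(1−y) log log x)`, constant `λ_f(y)·(e^{(y−1) log D} Γ(y)^{−k} − Γ(k(y−1)+1)^{−1})`), although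
every quantity in them is real for real `y`.  This file strips that bookkeeping once, for whoever attacks
the promoted kernel statement arithmetically:

* `exists_eulerFactor_ofReal` — for a Bateman–Horn system and real `y ≥ 1`, `λ_f(y) = eulerFactor f y`
  IS the real Levin–Faĭnleĭb product `P_f(y) = lim_N ∏_{p≤N} (Σ_ν b(p^ν))(1 − 1/p)^{k(y−1)}` of the
  Type-I coefficient `b = bCoeff f y`, and `Σ_{m≤D} b(m) ∼ P_f(y) (log D)^{k(y−1)}/Γ(k(y−1)+1)`
  (composition of the landed stubs `stub_typeILocal`, `stub_congruenceFacts`, `stub_levinFainleib`);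
  `eulerFactor_ofReal_re` records `λ_f(y) = (Re λ_f(y) : ℂ)`, and `eulerFactor_re_pos` that `λ_f(y) > 0`
  (the partial products are bounded below: `AZFG2020_tendsto_sum_sub_omega_div_holds` for each member `![fᵢ]`).
* `betaKernelLaw_iff_tendsto_real` — `BetaKernelLaw k f y ↔ K_x(y)/(x (log x)^{k(y−1)}) → Re λ_f(y)·
  (e^{(y−1) log D} Γ(y)^{−k} − Γ(k(y−1)+1)^{−1})` as REAL sequences (`D = ∏ natDegree fᵢ`).
* `segmentLaw_iff_tendsto_real` — the crux's segment law at `y` with `Λ = λ_f`, equivalently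
  `Σ_{n≤x} y^{s_f(n)}/(x (log x)^{k(y−1)}) → Re λ_f(y)·e^{(y−1) log D} Γ(y)^{−k}` over `ℝ`.
* `typeI_lower_bound` — UNCONDITIONALLY, for every Bateman–Horn system and every real `y > 1`:
  `Σ_{0≤n≤x} y^{s_f(n)} ≥ (Re λ_f(y)/Γ(k(y−1)+1) − ε)·x (log x)^{k(y−1)}` for all large `x`
  (Type-I half `typeILaw_holds` + `kernelSum_nonneg`): the level-`x` divisors alone give a lower bound of the
  predicted order with the explicit share-`Γ(y)^k D^{1−y}/Γ(k(y−1)+1)` constant; `sum_pow_stat_lower_bound`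
  is the qualitative form `Σ_{0≤n≤x} y^{s_f(n)} ≥ c_f(y)·x (log x)^{k(y−1)}`, `c_f(y) > 0`.

References: the line card `Cruxes/SystemLSDRealSegment/Lines/beta-thinned-root-kernel.md`; H. Halberstam,
H.-E. Richert, *Sieve Methods* (1974) Lemma 5.4.
-/

open Filter Finset Polynomial
open scoped BigOperators Topology

namespace Summit.Parity.BatemanHorn.Cruxes.SystemLSDRealSegment.BetaThinnedRootKernel

open Literature.NumberTheory.Sieve
open Summit.Parity.BatemanHorn.Cruxes.LSDRealSegment.ProductAnatomySubcritical (normaliser_ofReal_eq)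

noncomputable section

variable {k : ℕ} {f : Fin k → ℤ[X]}

/-! ### `λ_f(y)` is real: the Levin–Faĭnleĭb product of the Type-I coefficient -/

/-- **`λ_f(y)` at a real `y ≥ 1` is the real Levin–Faĭnleĭb product.** For a Bateman–Horn system `f` and
`1 ≤ y` there is `P : ℝ` with `eulerFactor f y = P`,
`∏_{p≤N} (Σ_ν b(p^ν))(1 − 1/p)^{k(y−1)} → P` and `Σ_{m≤D} b(m)/(log D)^{k(y−1)} → P/Γ(k(y−1)+1)`,
`b = bCoeff f y` (the landed `stub_typeILocal`, `stub_congruenceFacts`, `stub_levinFainleib`, composed as in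
`stub_typeILimit`). [folklore] -/
theorem exists_eulerFactor_ofReal (hf : IsBatemanHornSystem f) {y : ℝ} (hy : 1 ≤ y) :
    ∃ P : ℝ, eulerFactor f (y : ℂ) = (P : ℂ) ∧
      Tendsto (fun N : ℕ => ∏ p ∈ Nat.primesLE N,
        (∑' ν : ℕ, bCoeff f y (p ^ ν)) * (1 - 1 / (p : ℝ)) ^ ((k : ℝ) * (y - 1))) atTop (𝓝 P) ∧
      Tendsto (fun D : ℕ => (∑ d ∈ Icc 1 D, bCoeff f y d) / Real.log D ^ ((k : ℝ) * (y - 1))) atTop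
        (𝓝 (P / Real.Gamma ((k : ℝ) * (y - 1) + 1))) := by
  have hκ0 : 0 ≤ (k : ℝ) * (y - 1) := mul_nonneg (Nat.cast_nonneg _) (by linarith)
  obtain ⟨hb0, hb1, hbmul, hbp, hbz, hbpow, hloc⟩ := stub_typeILocal stub_congruenceFacts.2 k f hf y hy
  have hf0 : ∀ i, f i ≠ 0 := fun i => (hf.irreducible i).ne_zero
  have hH1 := bCoeff_primeMean f hy hbp fun i =>
    stub_congruenceFacts.1 (f i) (hf.irreducible i) (hf.natDegree_pos i)
  have hH2 := bCoeff_primePowers f hf0 hy hb0 hbp hbz hbpow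
  obtain ⟨P, hprod, hG⟩ :=
    stub_levinFainleib (bCoeff f y) ((k : ℝ) * (y - 1)) hκ0 hb0 hb1 hbmul hH1 hH2
  exact ⟨P, eulerFactor_ofReal_eq_of_tendsto f y hbz hloc hprod, hprod, hG⟩

/-- `λ_f(y)` is real for real `y ≥ 1`: `eulerFactor f y = (Re (eulerFactor f y) : ℂ)`. [folklore] -/
theorem eulerFactor_ofReal_re (hf : IsBatemanHornSystem f) {y : ℝ} (hy : 1 ≤ y) :
    eulerFactor f (y : ℂ) = (((eulerFactor f (y : ℂ)).re : ℝ) : ℂ) := by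
  obtain ⟨P, hP, -, -⟩ := exists_eulerFactor_ofReal hf hy
  rw [hP, Complex.ofReal_re]


/-! ### `λ_f(y) > 0` for real `y ≥ 1` -/

/-- Elementary: `exp(t − t²) ≤ 1 + t` for `t ≥ 0` (`log(1+t) ≥ 1 − (1+t)⁻¹ = t/(1+t) ≥ t − t²`).
[folklore] -/
theorem exp_sub_sq_le_one_add {t : ℝ} (ht : 0 ≤ t) : Real.exp (t - t ^ 2) ≤ 1 + t := by
  have h1 : 0 < 1 + t := by linarith
  have hlog : t - t ^ 2 ≤ Real.log (1 + t) := by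
    have h := Real.one_sub_inv_le_log_of_pos h1
    have h2 : t - t ^ 2 ≤ 1 - (1 + t)⁻¹ := by
      rw [show (1 : ℝ) - (1 + t)⁻¹ = t / (1 + t) by field_simp; ring, le_div_iff₀ h1]
      nlinarith [mul_nonneg ht (sq_nonneg t)]
    linarith
  calc Real.exp (t - t ^ 2) ≤ Real.exp (Real.log (1 + t)) := Real.exp_le_exp.2 hlog
    _ = 1 + t := Real.exp_log h1

/-- Elementary: `exp(κ(−u − 2u²)) ≤ (1 − u)^κ` for `0 ≤ u ≤ 1/2`, `κ ≥ 0`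
(`log(1 − u) ≥ −u − 2u²`, the tree's `abs_log_one_sub_add_le`). [folklore] -/
theorem exp_le_one_sub_rpow {u κ : ℝ} (hu0 : 0 ≤ u) (hu : u ≤ 1 / 2) (hκ : 0 ≤ κ) :
    Real.exp (κ * (-u - 2 * u ^ 2)) ≤ (1 - u) ^ κ := by
  have h1 : 0 < 1 - u := by linarith
  rw [Real.rpow_def_of_pos h1, mul_comm (Real.log _) κ]
  refine Real.exp_le_exp.2 (mul_le_mul_of_nonneg_left ?_ hκ)
  have h := (abs_le.1 (abs_log_one_sub_add_le hu0 hu)).1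
  linarith

/-- **`λ_f(y) > 0` for a Bateman–Horn system and real `y ≥ 1`.** The Levin–Faĭnleĭb partial products
are bounded below: each factor `(Σ_ν b(p^ν))(1 − 1/p)^{k(y−1)} ≥ (1 + b(p))(1 − 1/p)^{k(y−1)}
≥ exp(b(p) − b(p)² − k(y−1)/p − 2k(y−1)/p²)`, and `Σ_{p≤N} (b(p) − k(y−1)/p) = (y−1)Σᵢ Σ_{p≤N}(ρᵢ(p) − 1)/p`
is bounded below because each member `![fᵢ]` is a Bateman–Horn system
(`AZFG2020_tendsto_sum_sub_omega_div_holds`), while `b(p) ≤ C₁/p` makes `Σ b(p)²` and `Σ 1/p²` bounded.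
[folklore] -/
theorem eulerFactor_re_pos (hf : IsBatemanHornSystem f) {y : ℝ} (hy : 1 ≤ y) :
    0 < (eulerFactor f (y : ℂ)).re := by
  obtain ⟨P, hP, hprod, -⟩ := exists_eulerFactor_ofReal hf hy
  rw [hP, Complex.ofReal_re]
  set κ : ℝ := (k : ℝ) * (y - 1) with hκ
  have hy0 : 0 ≤ y - 1 := by linarith
  have hκ0 : 0 ≤ κ := mul_nonneg (Nat.cast_nonneg _) hy0
  obtain ⟨hb0, hb1, -, hbp, hbz, -, -⟩ := stub_typeILocal stub_congruenceFacts.2 k f hf y hy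
  have hf0 : ∀ i, f i ≠ 0 := fun i => (hf.irreducible i).ne_zero
  -- `b(p) ≤ C₁/p`
  set C₁ : ℝ := (y - 1) * ∑ i, (((f i).natDegree + (f i).leadingCoeff.natAbs : ℕ) : ℝ) with hC₁
  have hbC : ∀ p : ℕ, p.Prime → bCoeff f y p ≤ C₁ / p := fun p hp => bCoeff_prime_le f hf0 hy hbp hp
  -- AZFG for each member: `Σ_{p≤N} (1 − ρᵢ(p))/p ≤ Mᵢ`
  have hAZ : ∀ i, ∃ M : ℝ, ∀ N : ℕ,
      ∑ p ∈ Nat.primesLE N, ((1 : ℝ) - polyRootCountMod ![f i] p) / p ≤ M := by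
    intro i
    obtain ⟨L, hL⟩ := AZFG2020_tendsto_sum_sub_omega_div_holds 1 ![f i]
      (BatemanHornMertens.isBatemanHornSystem_single hf i)
    obtain ⟨M, hM⟩ := hL.bddAbove_range
    refine ⟨M, fun N => hM ⟨N, ?_⟩⟩
    simp only [Nat.cast_one]
  choose M hM using hAZ
  -- the uniform lower bound `exp(−B)` of the partial products
  set T : ℝ := ∑' n : ℕ, 1 / (n : ℝ) ^ 2 with hT
  have hTsum : Summable (fun n : ℕ => 1 / (n : ℝ) ^ 2) := Real.summable_one_div_nat_pow.2 one_lt_two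
  set B : ℝ := (y - 1) * ∑ i, M i + (C₁ ^ 2 + 2 * κ) * T with hB
  have hlow : ∀ N : ℕ, Real.exp (-B) ≤ ∏ p ∈ Nat.primesLE N,
      (∑' ν : ℕ, bCoeff f y (p ^ ν)) * (1 - 1 / (p : ℝ)) ^ κ := by
    intro N
    -- termwise: the factor at `p` is at least `exp(e_p)`
    set e : ℕ → ℝ := fun p => (bCoeff f y p - bCoeff f y p ^ 2) +
      κ * (-(1 / (p : ℝ)) - 2 * (1 / (p : ℝ)) ^ 2) with he
    have hterm : ∀ p ∈ Nat.primesLE N,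
        Real.exp (e p) ≤ (∑' ν : ℕ, bCoeff f y (p ^ ν)) * (1 - 1 / (p : ℝ)) ^ κ := by
      intro p hp
      have hp' := Nat.prime_of_mem_primesLE hp
      have hp2 : (2 : ℝ) ≤ p := by exact_mod_cast hp'.two_le
      have hu0 : (0 : ℝ) ≤ 1 / p := by positivity
      have hu : 1 / (p : ℝ) ≤ 1 / 2 := by gcongr
      rw [he, Real.exp_add]
      refine mul_le_mul ?_ (exp_le_one_sub_rpow hu0 hu hκ0) (Real.exp_pos _).le
        (tsum_nonneg fun ν => hb0 _)
      refine (exp_sub_sq_le_one_add (hb0 p)).trans ?_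
      have hsum : Summable fun ν : ℕ => bCoeff f y (p ^ ν) := by
        refine summable_of_ne_finset_zero (s := range (2 * k + 1)) fun ν hν => hbz p hp' ν ?_
        simpa using hν
      calc 1 + bCoeff f y p = ∑ ν ∈ ({0, 1} : Finset ℕ), bCoeff f y (p ^ ν) := by
            rw [Finset.sum_pair (by norm_num : (0 : ℕ) ≠ 1), pow_zero, pow_one, hb1]
        _ ≤ ∑' ν : ℕ, bCoeff f y (p ^ ν) := hsum.sum_le_tsum _ fun ν _ => hb0 _
    -- the exponent sum is at least `−B`
    have hsumE : -B ≤ ∑ p ∈ Nat.primesLE N, e p := by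
      -- main part: `Σ_p (b(p) − κ/p) = −(y−1) Σᵢ Σ_p (1 − ρᵢ(p))/p ≥ −(y−1) Σᵢ Mᵢ`
      have hmain : -((y - 1) * ∑ i, M i) ≤
          ∑ p ∈ Nat.primesLE N, (bCoeff f y p - κ * (1 / (p : ℝ))) := by
        have hrw : ∀ p ∈ Nat.primesLE N, bCoeff f y p - κ * (1 / (p : ℝ)) =
            -((y - 1) * ∑ i, ((1 : ℝ) - polyRootCountMod ![f i] p) / p) := by
          intro p hp
          rw [hbp p (Nat.prime_of_mem_primesLE hp), hκ]
          have hsum : ∑ i : Fin k, ((1 : ℝ) - polyRootCountMod ![f i] p) / p =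
              (k : ℝ) * (1 / p) - (∑ i : Fin k, (polyRootCountMod ![f i] p : ℝ)) / p := by
            rw [← Finset.sum_div, Finset.sum_sub_distrib, Finset.sum_const, Finset.card_univ,
              Fintype.card_fin, nsmul_eq_mul, mul_one]
            ring
          rw [hsum, ← Finset.sum_div]
          ring
        rw [Finset.sum_congr rfl hrw, Finset.sum_neg_distrib, ← Finset.mul_sum, Finset.sum_comm, neg_le_neg_iff]
        exact mul_le_mul_of_nonneg_left (Finset.sum_le_sum fun i _ => hM i N) hy0
      -- error part: `Σ_p (b(p)² + 2κ/p²) ≤ (C₁² + 2κ) T`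
      have herr : ∑ p ∈ Nat.primesLE N, (bCoeff f y p ^ 2 + 2 * κ * (1 / (p : ℝ)) ^ 2) ≤
          (C₁ ^ 2 + 2 * κ) * T := by
        have hle : ∀ p ∈ Nat.primesLE N, bCoeff f y p ^ 2 + 2 * κ * (1 / (p : ℝ)) ^ 2 ≤
            (C₁ ^ 2 + 2 * κ) * (1 / (p : ℝ) ^ 2) := by
          intro p hp
          have hp' := Nat.prime_of_mem_primesLE hp
          have hp0 : (0 : ℝ) < p := by exact_mod_cast hp'.pos
          have hb2 : bCoeff f y p ^ 2 ≤ C₁ ^ 2 / (p : ℝ) ^ 2 := by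
            have h := pow_le_pow_left₀ (hb0 p) (hbC p hp') 2
            rwa [div_pow] at h
          rw [one_div_pow,
            show (C₁ ^ 2 + 2 * κ) * (1 / (p : ℝ) ^ 2) = C₁ ^ 2 / (p : ℝ) ^ 2 + 2 * κ * (1 / (p : ℝ) ^ 2) by
              ring]
          linarith
        refine (Finset.sum_le_sum hle).trans ?_
        rw [← Finset.mul_sum]
        refine mul_le_mul_of_nonneg_left ?_ (by positivity)
        exact hTsum.sum_le_tsum _ fun n _ => by positivity
      have hsplit : ∑ p ∈ Nat.primesLE N, e p =
          ∑ p ∈ Nat.primesLE N, (bCoeff f y p - κ * (1 / (p : ℝ))) -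
            ∑ p ∈ Nat.primesLE N, (bCoeff f y p ^ 2 + 2 * κ * (1 / (p : ℝ)) ^ 2) := by
        rw [← Finset.sum_sub_distrib]
        refine Finset.sum_congr rfl fun p _ => ?_
        rw [he]
        ring
      rw [hsplit, hB]
      linarith
    calc Real.exp (-B) ≤ Real.exp (∑ p ∈ Nat.primesLE N, e p) := Real.exp_le_exp.2 hsumE
      _ = ∏ p ∈ Nat.primesLE N, Real.exp (e p) := Real.exp_sum _ _
      _ ≤ _ := Finset.prod_le_prod (fun p _ => (Real.exp_pos _).le) hterm
  exact lt_of_lt_of_le (Real.exp_pos _) (ge_of_tendsto' hprod hlow)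

/-! ### Real ↔ complex transfer for the normalised sequences -/

/-- A real sequence tends to a real limit iff its cast to `ℂ` does. [folklore] -/
theorem tendsto_ofReal_iff' {u : ℕ → ℝ} {c : ℝ} :
    Tendsto (fun x => ((u x : ℝ) : ℂ)) atTop (𝓝 (c : ℂ)) ↔ Tendsto u atTop (𝓝 c) := by
  constructor
  · intro h
    have h2 := (Complex.continuous_re.tendsto (c : ℂ)).comp h
    simp only [Function.comp_def, Complex.ofReal_re] at h2
    exact h2
  · intro h
    exact (Complex.continuous_ofReal.tendsto c).comp h

/-- The crux's normaliser applied to a real quantity `u x` is the cast of `u x / (x (log x)^{k(y−1)})`,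
for `x ≥ 2`. [folklore] -/
theorem normaliser_mul_ofReal_eq (k : ℕ) (y : ℝ) {x : ℕ} (hx : 2 ≤ x) (u : ℝ) :
    (x : ℂ)⁻¹ * Complex.exp ((k : ℂ) * (1 - (y : ℂ)) * (Real.log (Real.log x) : ℂ)) * (u : ℂ) =
      ((u / ((x : ℝ) * Real.log x ^ ((k : ℝ) * (y - 1))) : ℝ) : ℂ) := by
  rw [normaliser_ofReal_eq k y hx]
  push_cast
  ring

/-- The archimedean constant of the kernel law is real:
`e^{(y−1) log D}·Γ(y)^{−k} − Γ(k(y−1)+1)^{−1}` over `ℂ` is the cast of the same real expression. [folklore] -/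
theorem betaKernelArch_ofReal (k : ℕ) (f : Fin k → ℤ[X]) (y : ℝ) :
    Complex.exp (((y : ℂ) - 1) * (Real.log (∏ i, ((f i).natDegree : ℝ)) : ℂ)) * (Complex.Gamma y)⁻¹ ^ k -
        (Complex.Gamma ((k : ℂ) * ((y : ℂ) - 1) + 1))⁻¹ =
      ((Real.exp ((y - 1) * Real.log (∏ i, ((f i).natDegree : ℝ))) * (Real.Gamma y)⁻¹ ^ k -
        (Real.Gamma ((k : ℝ) * (y - 1) + 1))⁻¹ : ℝ) : ℂ) := by
  rw [show (k : ℂ) * ((y : ℂ) - 1) + 1 = (((k : ℝ) * (y - 1) + 1 : ℝ) : ℂ) by push_cast; ring,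
    Complex.Gamma_ofReal, Complex.Gamma_ofReal]
  push_cast
  ring

/-! ### The kernel law and the segment law as real statements -/

/-- **The open kernel law in real form.** For a Bateman–Horn system `f` and real `y ≥ 1`:
`BetaKernelLaw k f y ↔ K_x(y)/(x (log x)^{k(y−1)}) → Re λ_f(y)·(e^{(y−1) log D} Γ(y)^{−k} − Γ(k(y−1)+1)^{−1})`,
`D = ∏ᵢ natDegree fᵢ`, `K_x = kernelSum f y x`. [folklore] -/
theorem betaKernelLaw_iff_tendsto_real (hf : IsBatemanHornSystem f) {y : ℝ} (hy : 1 ≤ y) :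
    BetaKernelLaw k f y ↔
      Tendsto (fun x : ℕ => kernelSum f y x / ((x : ℝ) * Real.log x ^ ((k : ℝ) * (y - 1)))) atTop
        (𝓝 ((eulerFactor f (y : ℂ)).re *
          (Real.exp ((y - 1) * Real.log (∏ i, ((f i).natDegree : ℝ))) * (Real.Gamma y)⁻¹ ^ k -
            (Real.Gamma ((k : ℝ) * (y - 1) + 1))⁻¹))) := by
  rw [← tendsto_ofReal_iff', BetaKernelLaw, eulerFactor_ofReal_re hf hy, Complex.ofReal_re,
    betaKernelArch_ofReal, ← Complex.ofReal_mul]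
  refine Filter.tendsto_congr' ?_
  filter_upwards [eventually_ge_atTop 2] with x hx
  rw [normaliser_mul_ofReal_eq k y hx]

/-- **The segment law with `Λ = λ_f` in real form.** For a Bateman–Horn system `f` and real `y ≥ 1`:
the crux's convergence at `y` with `Λ := eulerFactor f` holds iff
`Σ_{0≤n≤x} y^{s_f(n)}/(x (log x)^{k(y−1)}) → Re λ_f(y)·e^{(y−1) log D} Γ(y)^{−k}` over `ℝ`. [folklore] -/
theorem segmentLaw_iff_tendsto_real (hf : IsBatemanHornSystem f) {y : ℝ} (hy : 1 ≤ y) :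
    Tendsto (fun x : ℕ => (x : ℂ)⁻¹ * Complex.exp ((k : ℂ) * (1 - (y : ℂ)) * (Real.log (Real.log x) : ℂ)) *
        ∑ n ∈ range (x + 1), (y : ℂ) ^ (∑ i, (((f i).eval (n : ℤ)).toNat.factorization.sum fun _ v => min v 2)))
      atTop
      (𝓝 (eulerFactor f y * Complex.exp (((y : ℂ) - 1) * (Real.log (∏ i, ((f i).natDegree : ℝ)) : ℂ)) *
        (Complex.Gamma y)⁻¹ ^ k)) ↔
    Tendsto (fun x : ℕ => (∑ n ∈ range (x + 1),
        y ^ (∑ i, (((f i).eval (n : ℤ)).toNat.factorization.sum fun _ v => min v 2))) /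
          ((x : ℝ) * Real.log x ^ ((k : ℝ) * (y - 1)))) atTop
      (𝓝 ((eulerFactor f (y : ℂ)).re *
        (Real.exp ((y - 1) * Real.log (∏ i, ((f i).natDegree : ℝ))) * (Real.Gamma y)⁻¹ ^ k))) := by
  have hlim : eulerFactor f y * Complex.exp (((y : ℂ) - 1) * (Real.log (∏ i, ((f i).natDegree : ℝ)) : ℂ)) *
      (Complex.Gamma y)⁻¹ ^ k =
      (((eulerFactor f (y : ℂ)).re *
        (Real.exp ((y - 1) * Real.log (∏ i, ((f i).natDegree : ℝ))) * (Real.Gamma y)⁻¹ ^ k) : ℝ) : ℂ) := by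
    conv_lhs => rw [eulerFactor_ofReal_re hf hy]
    rw [Complex.Gamma_ofReal]
    push_cast
    ring
  rw [hlim, ← tendsto_ofReal_iff']
  refine Filter.tendsto_congr' ?_
  filter_upwards [eventually_ge_atTop 2] with x hx
  rw [← typeISum_add_kernelSum f y x, ← normaliser_mul_ofReal_eq k y hx (typeISum f y x + kernelSum f y x),
    typeISum_add_kernelSum]
  push_cast
  rfl

/-! ### The unconditional Type-I lower bound -/

/-- **The Type-I half in real form** (landed `typeILaw_holds`): for a Bateman–Horn system and real `y > 1`,
`T_x(y)/(x (log x)^{k(y−1)}) → Re λ_f(y)/Γ(k(y−1)+1)`. [folklore] -/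
theorem typeILaw_tendsto_real (hf : IsBatemanHornSystem f) {y : ℝ} (hy : 1 < y) :
    Tendsto (fun x : ℕ => typeISum f y x / ((x : ℝ) * Real.log x ^ ((k : ℝ) * (y - 1)))) atTop
      (𝓝 ((eulerFactor f (y : ℂ)).re / Real.Gamma ((k : ℝ) * (y - 1) + 1))) := by
  have hT := typeILaw_holds k f hf y hy
  unfold TypeILaw at hT
  rw [eulerFactor_ofReal_re hf hy.le,
    show (k : ℂ) * ((y : ℂ) - 1) + 1 = (((k : ℝ) * (y - 1) + 1 : ℝ) : ℂ) by push_cast; ring,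
    Complex.Gamma_ofReal, ← Complex.ofReal_inv, ← Complex.ofReal_mul, ← div_eq_mul_inv] at hT
  rw [← tendsto_ofReal_iff']
  refine hT.congr' ?_
  filter_upwards [eventually_ge_atTop 2] with x hx
  rw [normaliser_mul_ofReal_eq k y hx]

/-- **Unconditional lower bound of the predicted order, every Bateman–Horn system, every real `y > 1`**:
for every `ε > 0` and all large `x`,
`Σ_{0≤n≤x} y^{s_f(n)} ≥ (Re λ_f(y)/Γ(k(y−1)+1) − ε) · x (log x)^{k(y−1)}`
(the level-`x` divisor tuples alone; the missing share `1 − Γ(y)^k D^{1−y}/Γ(k(y−1)+1)` of the predicted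
constant is exactly the open kernel law). [folklore] -/
theorem typeI_lower_bound (hf : IsBatemanHornSystem f) {y : ℝ} (hy : 1 < y) {ε : ℝ} (hε : 0 < ε) :
    ∀ᶠ x : ℕ in atTop,
      ((eulerFactor f (y : ℂ)).re / Real.Gamma ((k : ℝ) * (y - 1) + 1) - ε) *
          ((x : ℝ) * Real.log x ^ ((k : ℝ) * (y - 1))) ≤
        ∑ n ∈ range (x + 1), y ^ (∑ i, (((f i).eval (n : ℤ)).toNat.factorization.sum fun _ v => min v 2)) := by
  have hT := typeILaw_tendsto_real hf hy
  have hlow := (hT.eventually (Ioi_mem_nhds (sub_lt_self _ hε)))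
  filter_upwards [hlow, eventually_ge_atTop 2] with x hx hx2
  have hx2' : (2 : ℝ) ≤ x := by exact_mod_cast hx2
  have hpos : 0 < (x : ℝ) * Real.log x ^ ((k : ℝ) * (y - 1)) :=
    mul_pos (by linarith) (Real.rpow_pos_of_pos (Real.log_pos (by linarith)) _)
  rw [lt_div_iff₀ hpos] at hx
  rw [← typeISum_add_kernelSum f y x]
  have hK := kernelSum_nonneg f hy.le x
  linarith

/-- **Lower bound of the predicted order, qualitative form**: for every Bateman–Horn system `f` and real
`y > 1` there is `c > 0` with `Σ_{0≤n≤x} y^{s_f(n)} ≥ c · x (log x)^{k(y−1)}` for all large `x`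
(`c = λ_f(y)/(2Γ(k(y−1)+1))`, positive by `eulerFactor_re_pos`). [folklore] -/
theorem sum_pow_stat_lower_bound (hf : IsBatemanHornSystem f) {y : ℝ} (hy : 1 < y) :
    ∃ c : ℝ, 0 < c ∧ ∀ᶠ x : ℕ in atTop,
      c * ((x : ℝ) * Real.log x ^ ((k : ℝ) * (y - 1))) ≤
        ∑ n ∈ range (x + 1), y ^ (∑ i, (((f i).eval (n : ℤ)).toNat.factorization.sum fun _ v => min v 2)) := by
  have hΓ : 0 < Real.Gamma ((k : ℝ) * (y - 1) + 1) :=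
    Real.Gamma_pos_of_pos (by nlinarith [(Nat.cast_nonneg k : (0 : ℝ) ≤ k)])
  have hc : 0 < (eulerFactor f (y : ℂ)).re / Real.Gamma ((k : ℝ) * (y - 1) + 1) :=
    div_pos (eulerFactor_re_pos hf hy.le) hΓ
  refine ⟨(eulerFactor f (y : ℂ)).re / Real.Gamma ((k : ℝ) * (y - 1) + 1) / 2, by positivity, ?_⟩
  filter_upwards [typeI_lower_bound hf hy (half_pos hc)] with x hx
  convert hx using 2
  ring

/-- **sumPowStat_lower_bound** (registered helper statement of the crux item, closed form of
`sum_pow_stat_lower_bound`): for every Bateman–Horn system `f` and every real `y > 1` there is `c > 0` with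
`Σ_{0≤n≤x} y^{s_f(n)} ≥ c · x (log x)^{k(y−1)}` for all large `x`. [folklore] -/
theorem sumPowStat_lower_bound : ∀ (k : ℕ) (f : Fin k → ℤ[X]), IsBatemanHornSystem f → ∀ y : ℝ, 1 < y → ∃ c : ℝ, 0 < c ∧ ∀ᶠ x : ℕ in atTop, c * ((x : ℝ) * Real.log x ^ ((k : ℝ) * (y - 1))) ≤ ∑ n ∈ Finset.range (x + 1), y ^ (∑ i, (((f i).eval (n : ℤ)).toNat.factorization.sum fun _ v => min v 2)) :=
  fun _k _f hf _y hy => sum_pow_stat_lower_bound hf hy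

end

end Summit.Parity.BatemanHorn.Cruxes.SystemLSDRealSegment.BetaThinnedRootKernel
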